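import Mathlib
import Literature.Computability.AlgebraicComplexity.StandardFamilies
import Literature.Computability.AlgebraicComplexity.BorderQWordClosure
import Summits.ValiantsHypothesis.ValiantsHypothesis.Theses.ElementaryWordLength
import Summits.ValiantsHypothesis.ValiantsHypothesis.Theorems.ElementaryWordLengthWordLengthQPStubIbqAdd
import Summits.ValiantsHypothesis.ValiantsHypothesis.Theorems.ElementaryWordLengthWordLengthQPStubIbqSmul
import Summits.ValiantsHypothesis.ValiantsHypothesis.Theorems.ElementaryWordLengthWordLengthQPStubIbqCube
import Summits.ValiantsHypothesis.ValiantsHypothesis.Theorems.ElementaryWordLengthWordLengthQPStubIbqSquare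
import Summits.ValiantsHypothesis.ValiantsHypothesis.Theorems.ElementaryWordLengthWordLengthQPLadderIff

/-!
# Crux `WordLengthQP` (stmt-ValiantsHypothesis-6623), line `Sketch` (eps-order-ladder) —
the crux implies the rungs `q ≥ 1` of the ε-order ladder with witnesses `n ≥ 10`

Skeleton v8/v9 of the line splits the ε-order ladder `EpsOrderLadder` (≡ the crux, tree theorem
`ladder_iff_wordLengthQP`, p110600) into its exact rung `q = 0` (now a theorem for `n ≥ 10`,
`rung0_nonuniversal`) and the open stub `stub_ladder_pos`: for every `c` some `n ≥ 10` admits no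
border width-2 S-affine program for `per_n` with `1 ≤ q ≤ 2^((log₂ n + c)^c)`,
`L ≤ 2^((log₂ n + c)^c)`.  This file proves the converse direction
`ladderPos_of_wordLengthQP : WordLengthQP → stub_ladder_pos`, so that the open stub is again
CERTIFIED crux-equivalent (with `rung0_wordLengthQP_of_ladder_pos`).  The only new ingredient is
UNIVERSALITY of border width 2 for the permanent at explicit (exponential) cost
(`ladderPos_universal`, from the tree's BIZ18 gadget calculus `BorderQWord.ibq_list_prod` /
`ibq_finset_sum` run on `per_n = ∑_ρ ∏ᵢ x_{ρ i, i}` with the landed gadgets `stub_ibqAdd`,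
`stub_ibqSmul`, `stub_ibqCube`, `stub_ibqSquare`): it forces the ladder's witness `n` to be `≥ 10`
as soon as `c ≥ 4`, because for `n ≤ 9` the universal program fits under `2^((log₂ n + 4)^4)`.

References: K. Bringmann, C. Ikenmeyer, J. Zuiddam, J. ACM 65 (2018) §3 (Thm 3.1).
-/

-- `Summit.ValiantsHypothesis.ValiantsHypothesis.…` is the tree's mandated single-conjunct layout
-- (Sub = Summit), so the duplicated namespace component is intended.
set_option linter.dupNamespace false

noncomputable section

open MvPolynomial

namespace Summit.ValiantsHypothesis.ValiantsHypothesis.Cruxes.WordLengthQP.EpsOrderLadder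

open Literature.Computability.AlgebraicComplexity

/-- `IBQ[σ | f, μ, κ, L]` (local notation, as in `BorderQWordClosure.lean`): `f` has an integral
border Q-word of shift `≤ μ`, precision `κ`, length `≤ L`. -/
local notation3 (prettyPrint := false) "IBQ[" σ " | " f ", " μ ", " κ ", " L "]" =>
  ∃ w : List ((Polynomial ℂ × Option σ) × ℕ), w.length ≤ L ∧ ∃ M : ℕ, M ≤ μ ∧
    ∃ G : Matrix (Fin 2) (Fin 2) (MvPolynomial σ (Polynomial ℂ)),
      (w.map (fun l => (!![MvPolynomial.C l.1.1 * l.1.2.elim 1 MvPolynomial.X,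
          MvPolynomial.C (Polynomial.X ^ l.2); MvPolynomial.C (Polynomial.X ^ l.2), 0] :
            Matrix (Fin 2) (Fin 2) (MvPolynomial σ (Polynomial ℂ))))).prod
        = (MvPolynomial.C (Polynomial.X ^ M) : MvPolynomial σ (Polynomial ℂ)) •
            (!![MvPolynomial.map Polynomial.C f, 1; 1, 0] :
              Matrix (Fin 2) (Fin 2) (MvPolynomial σ (Polynomial ℂ)))
          + (MvPolynomial.C (Polynomial.X ^ (M + κ)) : MvPolynomial σ (Polynomial ℂ)) • G

/-- **Universality of border width 2 for the permanent, explicit cost** (BIZ18 Thm 3.1 run on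
`per_n = ∑_ρ ∏ᵢ x_{ρ i, i}`): `per_n` has an integral border Q-word of precision `1`, shift
`≤ n! · 3 · 25ⁿ` and length `≤ n! · (21 · 9ⁿ + 1) + 1`. -/
theorem ladderPos_ibq_perPoly (n : ℕ) :
    IBQ[Fin n × Fin n | perPoly (Fin n) ℂ, Nat.factorial n * (3 * 25 ^ n), 1,
      Nat.factorial n * (21 * 9 ^ n + 1) + 1] := by
  -- each permutation product `∏ᵢ x_{ρ i, i}` at precision 3
  have hprod : ∀ ρ ∈ (Finset.univ : Finset (Equiv.Perm (Fin n))),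
      IBQ[Fin n × Fin n | (∏ i, (X (ρ i, i) : MvPolynomial (Fin n × Fin n) ℂ)),
        25 ^ n * (0 + 3), 3, 9 ^ n * (1 + 20)] := by
    intro ρ _
    have h := BorderQWord.ibq_list_prod (σ := Fin n × Fin n) stub_ibqAdd stub_ibqSmul
      stub_ibqCube stub_ibqSquare
      (T := List.ofFn (fun i : Fin n => (X (ρ i, i) : MvPolynomial (Fin n × Fin n) ℂ)))
      (m := 0) (b := 1) (fun p hp => by
        rw [List.mem_ofFn] at hp
        obtain ⟨i, rfl⟩ := hp
        exact BorderQWord.ibq_X (σ := Fin n × Fin n) (ρ i, i) 3)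
    rwa [List.prod_ofFn, List.length_ofFn] at h
  have hsum := BorderQWord.ibq_finset_sum (σ := Fin n × Fin n) stub_ibqAdd Finset.univ hprod
  have hper : (∑ ρ : Equiv.Perm (Fin n), ∏ i, (X (ρ i, i) : MvPolynomial (Fin n × Fin n) ℂ)) =
      perPoly (Fin n) ℂ := by
    rw [perPoly, Matrix.permanent]
    rfl
  rw [hper, Finset.card_univ, Fintype.card_perm, Fintype.card_fin] at hsum
  have h1 := BorderQWord.ibq_prec hsum (show 1 ≤ 3 by norm_num)
  exact BorderQWord.ibq_mono h1 (by ring_nf; omega) (by ring_nf; omega)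

/-- **Universality as a border S-affine program** for the crux's ladder format: `per_n` is the
`ε^q`-leading `(0,0)` coefficient of a product of `≤ n!(21·9ⁿ+1)+1` width-2 matrices over
`ℂ[ε][x̄]` with S-affine entries, `q ≤ 3 · 25ⁿ · n!`. -/
theorem ladderPos_universal (n : ℕ) :
    ∃ (q : ℕ) (ms : List (Matrix (Fin 2) (Fin 2) (MvPolynomial (Fin n × Fin n) (Polynomial ℂ)))),
      q ≤ Nat.factorial n * (3 * 25 ^ n) ∧
      ms.length ≤ Nat.factorial n * (21 * 9 ^ n + 1) + 1 ∧
      (∀ m ∈ ms, ∀ i j : Fin 2, (∃ b : Polynomial ℂ, m i j = MvPolynomial.C b) ∨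
        (∃ (a b : Polynomial ℂ) (v : Fin n × Fin n),
          m i j = MvPolynomial.C a * MvPolynomial.X v + MvPolynomial.C b)) ∧
      ∃ G : MvPolynomial (Fin n × Fin n) (Polynomial ℂ),
        ms.prod 0 0 = MvPolynomial.C (Polynomial.X ^ q) *
            MvPolynomial.map Polynomial.C (perPoly (Fin n) ℂ) +
          MvPolynomial.C (Polynomial.X ^ (q + 1)) * G := by
  obtain ⟨w, hw, M, hM, G, hG⟩ := ladderPos_ibq_perPoly n
  refine ⟨M, w.map (fun l => (!![MvPolynomial.C l.1.1 * l.1.2.elim 1 MvPolynomial.X,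
      MvPolynomial.C (Polynomial.X ^ l.2); MvPolynomial.C (Polynomial.X ^ l.2), 0] :
        Matrix (Fin 2) (Fin 2) (MvPolynomial (Fin n × Fin n) (Polynomial ℂ)))),
    hM, by simpa using hw, ?_, G 0 0, ?_⟩
  · intro m hm i j
    obtain ⟨l, -, rfl⟩ := List.mem_map.1 hm
    obtain ⟨⟨a, o⟩, k⟩ := l
    fin_cases i <;> fin_cases j
    · cases o with
      | none => exact Or.inl ⟨a, by simp⟩
      | some v => exact Or.inr ⟨a, 0, v, by simp⟩
    · exact Or.inl ⟨Polynomial.X ^ k, by simp⟩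
    · exact Or.inl ⟨Polynomial.X ^ k, by simp⟩
    · exact Or.inl ⟨0, by simp⟩
  · have h00 := congrFun (congrFun hG 0) 0
    simp only [Matrix.add_apply, Matrix.smul_apply, smul_eq_mul, Matrix.of_apply,
      Matrix.cons_val', Matrix.cons_val_zero, Matrix.cons_val_fin_one] at h00
    rw [h00]

/-- For `n ≤ 9` the universal program fits under `2^64`. [folklore] -/
theorem ladderPos_small (n : ℕ) (hn : n ≤ 9) :
    Nat.factorial n * (3 * 25 ^ n) ≤ 2 ^ 64 ∧ Nat.factorial n * (21 * 9 ^ n + 1) + 1 ≤ 2 ^ 64 := by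
  interval_cases n <;> simp [Nat.factorial]

/-- Monotonicity of the ladder bound's exponent in `c`. [folklore] -/
theorem ladderPos_exp_mono (x c c' : ℕ) (h : c ≤ c') (hc' : 1 ≤ c') :
    (x + c) ^ c ≤ (x + c') ^ c' :=
  (Nat.pow_le_pow_left (by omega) c).trans (Nat.pow_le_pow_right (by omega) h)

/-- **The crux implies the rungs `q ≥ 1` with witnesses `n ≥ 10`** (`stub_ladder_pos` of the
skeleton): from `X` the full ladder holds (`ladder_of_wordLengthQP`); its witness at exponent
`max c 4` cannot be `≤ 9` by universality (`ladderPos_universal`, `ladderPos_small`), and the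
ladder at `max c 4` implies the rungs at `c`. -/
theorem ladderPos_of_wordLengthQP
    (hX : Summit.ValiantsHypothesis.ValiantsHypothesis.Theses.ElementaryWordLength.WordLengthQP) :
    ∀ c : ℕ, ∃ n : ℕ, 10 ≤ n ∧ ∀ q L : ℕ, 1 ≤ q → q ≤ 2 ^ ((Nat.log 2 n + c) ^ c) →
      L ≤ 2 ^ ((Nat.log 2 n + c) ^ c) →
      ¬ (∃ ms : List (Matrix (Fin 2) (Fin 2) (MvPolynomial (Fin n × Fin n) (Polynomial ℂ))),
          ms.length ≤ L ∧
          (∀ m ∈ ms, ∀ i j : Fin 2, (∃ b : Polynomial ℂ, m i j = MvPolynomial.C b) ∨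
            (∃ (a b : Polynomial ℂ) (v : Fin n × Fin n),
              m i j = MvPolynomial.C a * MvPolynomial.X v + MvPolynomial.C b)) ∧
          ∃ G : MvPolynomial (Fin n × Fin n) (Polynomial ℂ),
            ms.prod 0 0 = MvPolynomial.C (Polynomial.X ^ q) *
                MvPolynomial.map Polynomial.C
                  (Literature.Computability.AlgebraicComplexity.perPoly (Fin n) ℂ) +
              MvPolynomial.C (Polynomial.X ^ (q + 1)) * G) := by
  intro c
  obtain ⟨n, hn⟩ := ladder_of_wordLengthQP hX (max c 4)
  have hexp : 2 ^ 64 ≤ 2 ^ ((Nat.log 2 n + max c 4) ^ (max c 4)) := by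
    refine Nat.pow_le_pow_right (by norm_num) ?_
    calc 64 ≤ (0 + 4) ^ 4 := by norm_num
      _ ≤ (0 + max c 4) ^ (max c 4) := ladderPos_exp_mono 0 4 _ (le_max_right _ _) (by omega)
      _ ≤ (Nat.log 2 n + max c 4) ^ (max c 4) := Nat.pow_le_pow_left (by omega) _
  have hn10 : 10 ≤ n := by
    by_contra hlt
    obtain ⟨q, ms, hq, hlen, hS, G, hG⟩ := ladderPos_universal n
    obtain ⟨hq', hlen'⟩ := ladderPos_small n (by omega)
    exact hn q ms.length (hq.trans (hq'.trans hexp)) (hlen.trans (hlen'.trans hexp))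
      ⟨ms, le_rfl, hS, G, hG⟩
  have hmono : 2 ^ ((Nat.log 2 n + c) ^ c) ≤ 2 ^ ((Nat.log 2 n + max c 4) ^ (max c 4)) :=
    Nat.pow_le_pow_right (by norm_num) (ladderPos_exp_mono _ _ _ (le_max_left _ _) (by omega))
  exact ⟨n, hn10, fun q L _ hq hL => hn q L (hq.trans hmono) (hL.trans hmono)⟩

end Summit.ValiantsHypothesis.ValiantsHypothesis.Cruxes.WordLengthQP.EpsOrderLadder
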